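import Mathlib
import HarnessLib

/-!
# Transverse subgroups of a `p^m`-torsion group with `#H[p] ≤ p²`: the cyclicity / complement step
# of brick B3 — pure algebra (cell `b2b-bsdres`, CLASS-CLOSURE lane, class O10 — x1b GEN 39, class
# lead; file 83 of the series)

HONEST FRAMING (cell `b2b-bsdres`, run/shared/lean/b2b/bsd-rank1-residual/, verbatim in every
file): the goal of the cell is to DELETE the COMBINATION-SHAPED residual classes of the
Birch–Swinnerton-Dyer formula for ALL analytic-rank `≤ 1` elliptic curves over `ℚ` — "full BSD
formula for every rank `≤ 1` curve in class `C`" assembled STRICTLY from published theorems — so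
that the rank-`≤ 1` remainder becomes exactly the CONSTRUCTION-SHAPED classes, which are TYPED
(missing-input `Prop`s), NOT attempted. This is not "finishing BSD". CLASS-CLOSURE lane: prove
what is provable now; shrink each hard class to its core with data; no claim beyond stated classes;
research routes on CONSTRUCTION-SHAPED X12 / O10; census / instrument output = EVIDENCE / conjecture
items, NEVER a Literature fact; `RESIDUAL-MAP.md` marks change only by signed lines. THIS FILE:
PURE ALGEBRA, TOOL THEOREMS ONLY — no definition, no named Literature fact, no `sorry`, axioms
standard; nothing is booked; no label / mark / count / sub-cell moves; nothing about any curve.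

## What

The last LOCAL step of brick B3 of the count (C) in level-`m` shape ("the minus line `C_m` is cyclic
of order `p^m` with `C_m ⊔ 𝓚_p = ⊤`", files 60–78), as finite abelian group theory: in
`H = H¹(E, E[p^m])` (killed by `p^m`, `#H[p] = #H¹(E, E[p]) = p²` by the local Euler characteristic
and duality — the fact-shaped inputs of file 78), the Kummer group `𝓚 = E(E)/p^m` is cyclic of order
`p^m`, the minus condition `Σ_m` meets it trivially (transversality, KERNEL GEN 31/32) and has
`≥ p^m` elements (files 79–82, given witnesses); THEN `Σ_m ⊕ 𝓚 = H`, `#Σ_m = p^m`, `#H = p^{2m}`,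
and `Σ_m` is cyclic:

* `card_ker_pow_succ_le`, `card_ker_pow_le`, `card_le_pow_of_pow_smul_eq_zero`
  (`#G[n^{j+1}] ≤ #G[n]·#G[n^j]`, so a group killed by `n^m` has `≤ (#G[n])^m` elements);
* `exists_addOrderOf_eq_of_card_ker_le` (cyclicity criterion: killed by `p^m`, `#G[p] ≤ p`,
  `#G ≥ p^m` ⟹ `#G = p^m` and an element of order `p^m`);
* **`sup_eq_top_and_card_eq`**: `H` finite killed by `p^m` with `#H[p] ≤ p²`, `K ≤ H` of order
  `p^m` with an element of order `p^m`, `S ≤ H` with `S ∩ K = 0` and `#S ≥ p^m` ⟹ `S ⊔ K = ⊤`,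
  `#S = p^m`, `#H = p^{2m}`, `S` has an element of order `p^m`.

References: [Kobayashi2003] S. Kobayashi, Invent. Math. 152 (2003), Thm. 6.2 (p. 11);
[MilneADT2006] J. S. Milne, *Arithmetic Duality Theorems*, I.2.8 / I.3.3 (the inputs `#H¹(E, E[p])
= p²`, `#E(E)/p^m = p^m` are consumed elsewhere, not here).
-/

noncomputable section

open scoped Classical

namespace Summit.BirchSwinnertonDyer.Rank1Residual.Additive.TransverseLine

section Filtration

variable {G : Type*} [AddCommGroup G] [Finite G]

/-- `#G[n^{j+1}] ≤ #G[n] · #G[n^j]`: multiplication by `n` maps `G[n^{j+1}]` to `G[n^j]` with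
kernel inside `G[n]`. [folklore] -/
theorem card_ker_pow_succ_le (n j : ℕ) :
    Nat.card (nsmulAddMonoidHom (n ^ (j + 1)) : G →+ G).ker ≤
      Nat.card (nsmulAddMonoidHom n : G →+ G).ker * Nat.card (nsmulAddMonoidHom (n ^ j) : G →+ G).ker := by
  let A := (nsmulAddMonoidHom (n ^ (j + 1)) : G →+ G).ker
  let B := (nsmulAddMonoidHom (n ^ j) : G →+ G).ker
  let C := (nsmulAddMonoidHom n : G →+ G).ker
  -- `ψ : A → B`, `x ↦ n • x`
  have hmapsto : ∀ x : A, n • (x : G) ∈ B := fun x => by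
    have hx : n ^ (j + 1) • (x : G) = 0 := x.2
    rw [pow_succ, mul_nsmul'] at hx
    exact hx
  let ψ : A →+ B := ((nsmulAddMonoidHom n : G →+ G).comp A.subtype).codRestrict B
    (fun x => hmapsto x)
  have hker : Nat.card ψ.ker ≤ Nat.card C := by
    refine Nat.card_le_card_of_injective (fun x => ⟨(x.1 : G), ?_⟩) ?_
    · have hx := x.2
      rw [AddMonoidHom.mem_ker] at hx
      have : ((ψ x.1 : B) : G) = 0 := by rw [hx]; rfl
      exact this
    · intro x y hxy
      simp only [Subtype.mk.injEq] at hxy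
      exact Subtype.ext (Subtype.ext hxy)
  have hrange : Nat.card ψ.range ≤ Nat.card B := AddSubgroup.card_le_card_addGroup ψ.range
  change Nat.card A ≤ Nat.card C * Nat.card B
  calc Nat.card A = Nat.card (A ⧸ ψ.ker) * Nat.card ψ.ker :=
        AddSubgroup.card_eq_card_quotient_mul_card_addSubgroup ψ.ker
    _ = Nat.card ψ.range * Nat.card ψ.ker := by
        rw [Nat.card_congr (QuotientAddGroup.quotientKerEquivRange ψ).toEquiv]
    _ ≤ Nat.card B * Nat.card C := Nat.mul_le_mul hrange hker
    _ = Nat.card C * Nat.card B := mul_comm _ _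

/-- `#G[n^j] ≤ (#G[n])^j`. [folklore] -/
theorem card_ker_pow_le (n : ℕ) :
    ∀ j : ℕ, Nat.card (nsmulAddMonoidHom (n ^ j) : G →+ G).ker ≤
      (Nat.card (nsmulAddMonoidHom n : G →+ G).ker) ^ j
  | 0 => by
    rw [pow_zero, pow_zero]
    have : (nsmulAddMonoidHom 1 : G →+ G).ker = ⊥ := by
      ext x; simp [AddMonoidHom.mem_ker]
    rw [this, AddSubgroup.card_bot]
  | j + 1 => by
    calc Nat.card (nsmulAddMonoidHom (n ^ (j + 1)) : G →+ G).ker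
        ≤ Nat.card (nsmulAddMonoidHom n : G →+ G).ker * Nat.card (nsmulAddMonoidHom (n ^ j) : G →+ G).ker :=
          card_ker_pow_succ_le n j
      _ ≤ Nat.card (nsmulAddMonoidHom n : G →+ G).ker *
            (Nat.card (nsmulAddMonoidHom n : G →+ G).ker) ^ j :=
          Nat.mul_le_mul_left _ (card_ker_pow_le n j)
      _ = (Nat.card (nsmulAddMonoidHom n : G →+ G).ker) ^ (j + 1) := by rw [pow_succ']

/-- A group killed by `n^m` has `#G ≤ (#G[n])^m`. [folklore] -/
theorem card_le_pow_of_pow_smul_eq_zero (n m : ℕ) (hexp : ∀ g : G, n ^ m • g = 0) :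
    Nat.card G ≤ (Nat.card (nsmulAddMonoidHom n : G →+ G).ker) ^ m := by
  have htop : (nsmulAddMonoidHom (n ^ m) : G →+ G).ker = ⊤ := by
    ext g; simp [AddMonoidHom.mem_ker, hexp g]
  have h := card_ker_pow_le (G := G) n m
  rwa [htop, AddSubgroup.card_top] at h

/-- **Cyclicity criterion**: a finite abelian group killed by `p^m` with at most `p` elements
killed by `p` and at least `p^m` elements has exactly `p^m` elements and an element of order `p^m`.
[folklore] -/
theorem exists_addOrderOf_eq_of_card_ker_le {p : ℕ} (hp : p.Prime) (m : ℕ)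
    (hexp : ∀ g : G, p ^ m • g = 0) (hGp : Nat.card (nsmulAddMonoidHom p : G →+ G).ker ≤ p)
    (hG : p ^ m ≤ Nat.card G) :
    Nat.card G = p ^ m ∧ ∃ g : G, addOrderOf g = p ^ m := by
  have hcard : Nat.card G = p ^ m := le_antisymm
    ((card_le_pow_of_pow_smul_eq_zero p m hexp).trans (Nat.pow_le_pow_left hGp m)) hG
  refine ⟨hcard, ?_⟩
  rcases Nat.eq_zero_or_pos m with rfl | hm
  · refine ⟨0, ?_⟩
    rw [pow_zero, addOrderOf_zero]
  by_contra hne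
  push Not at hne
  -- every element is killed by `p^(m-1)`
  have hexp' : ∀ g : G, p ^ (m - 1) • g = 0 := by
    intro g
    obtain ⟨i, hi, hi'⟩ := (Nat.dvd_prime_pow hp).mp (addOrderOf_dvd_iff_nsmul_eq_zero.mpr (hexp g))
    have him : i ≤ m - 1 := by
      rcases Nat.lt_or_ge i m with h | h
      · omega
      · exfalso; exact hne g (by rw [hi']; congr 1; omega)
    exact addOrderOf_dvd_iff_nsmul_eq_zero.mp (hi' ▸ pow_dvd_pow p him)
  have h1 := (card_le_pow_of_pow_smul_eq_zero p (m - 1) hexp').trans (Nat.pow_le_pow_left hGp (m - 1))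
  rw [hcard] at h1
  have h2 : p ^ (m - 1) < p ^ m := Nat.pow_lt_pow_right hp.one_lt (by omega)
  omega

end Filtration

section Main

variable {H : Type*} [AddCommGroup H] [Finite H]

/-- **The transverse line.** `H` a finite abelian group killed by `p^m` with `#H[p] ≤ p²` (for the
count: `H = H¹(E, E[p^m])`, `#H¹(E, E[p]) = p²`), `K ≤ H` of order `p^m` containing an element of
order `p^m` (the Kummer group `E(E)/p^m`), and `S ≤ H` meeting `K` trivially with at least `p^m`
elements (the level-`m` minus condition: transversality + files 79–82). Then `S ⊕ K = H`,
`#S = p^m`, `#H = p^{2m}`, and `S` has an element of order `p^m` (so `S` is cyclic) — B3 in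
level-`m` shape. [folklore] -/
theorem sup_eq_top_and_card_eq {p : ℕ} (hp : p.Prime) (m : ℕ) (hexp : ∀ h : H, p ^ m • h = 0)
    (hHp : Nat.card (nsmulAddMonoidHom p : H →+ H).ker ≤ p ^ 2)
    (K S : AddSubgroup H) (hKcard : Nat.card K = p ^ m) (hk₀ : ∃ k ∈ K, addOrderOf k = p ^ m)
    (hdisj : ∀ x ∈ S, x ∈ K → x = 0) (hS : p ^ m ≤ Nat.card S) :
    S ⊔ K = ⊤ ∧ Nat.card S = p ^ m ∧ Nat.card H = p ^ (2 * m) ∧ ∃ s ∈ S, addOrderOf s = p ^ m := by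
  -- (a) `S × K ↪ H`
  have hsep : ∀ s s' : S, ∀ k k' : K, (s : H) + k = s' + k' → s = s' ∧ k = k' := by
    intro s s' k k' h
    have h1 : (s : H) - s' = k' - k := by
      rw [sub_eq_sub_iff_add_eq_add, add_comm (k' : H)]; exact h
    have h2 : (s : H) - s' ∈ K := h1 ▸ K.sub_mem k'.2 k.2
    have h3 : (s : H) - s' = 0 := hdisj _ (S.sub_mem s.2 s'.2) h2
    have hs : s = s' := Subtype.ext (sub_eq_zero.mp h3)
    refine ⟨hs, Subtype.ext ?_⟩
    rw [hs] at h
    exact add_left_cancel h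
  have hinj : Function.Injective (fun q : S × K => (q.1 : H) + q.2) := by
    rintro ⟨s, k⟩ ⟨s', k'⟩ h
    obtain ⟨hs, hk⟩ := hsep s s' k k' h
    rw [hs, hk]
  have hSK : Nat.card S * Nat.card K ≤ Nat.card H := by
    rw [← Nat.card_prod]; exact Nat.card_le_card_of_injective _ hinj
  -- (b) `#H ≤ p^{2m}`
  have hH : Nat.card H ≤ p ^ (2 * m) := by
    rw [pow_mul]
    exact (card_le_pow_of_pow_smul_eq_zero p m hexp).trans (Nat.pow_le_pow_left hHp m)
  -- (c) the counts
  have hppos : 0 < p ^ m := pow_pos hp.pos m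
  have hScard : Nat.card S = p ^ m := by
    refine le_antisymm ?_ hS
    have h1 : Nat.card S * p ^ m ≤ p ^ m * p ^ m :=
      calc Nat.card S * p ^ m = Nat.card S * Nat.card K := by rw [hKcard]
        _ ≤ Nat.card H := hSK
        _ ≤ p ^ (2 * m) := hH
        _ = p ^ m * p ^ m := by rw [two_mul, pow_add]
    exact Nat.le_of_mul_le_mul_right h1 hppos
  have hHcard : Nat.card H = p ^ (2 * m) := by
    refine le_antisymm hH ?_
    calc p ^ (2 * m) = p ^ m * p ^ m := by rw [two_mul, pow_add]
      _ = Nat.card S * Nat.card K := by rw [hScard, hKcard]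
      _ ≤ Nat.card H := hSK
  -- (d) `S ⊔ K = ⊤`
  have hsup : S ⊔ K = ⊤ := by
    apply AddSubgroup.eq_top_of_card_eq
    refine le_antisymm (AddSubgroup.card_le_card_addGroup _) ?_
    have hinj' : Function.Injective (fun q : S × K =>
        (⟨(q.1 : H) + q.2, AddSubgroup.add_mem_sup q.1.2 q.2.2⟩ : ↥(S ⊔ K))) := by
      rintro ⟨s, k⟩ ⟨s', k'⟩ h
      simp only [Subtype.mk.injEq] at h
      obtain ⟨hs, hk⟩ := hsep s s' k k' h
      rw [hs, hk]
    have := Nat.card_le_card_of_injective _ hinj'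
    rwa [Nat.card_prod, hScard, hKcard, ← pow_add, ← two_mul, ← hHcard] at this
  -- (e) an element of order `p^m` in `S`: `#S[p] ≤ p`
  refine ⟨hsup, hScard, hHcard, ?_⟩
  rcases Nat.eq_zero_or_pos m with rfl | hm
  · exact ⟨0, S.zero_mem, by rw [pow_zero, addOrderOf_zero]⟩
  obtain ⟨k₀, hk₀K, hk₀ord⟩ := hk₀
  set k₁ : H := p ^ (m - 1) • k₀ with hk₁
  have hk₁K : k₁ ∈ K := K.nsmul_mem hk₀K _
  have hk₁ord : addOrderOf k₁ = p := by
    rw [hk₁, addOrderOf_nsmul_of_dvd (pow_ne_zero _ hp.ne_zero)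
      (hk₀ord ▸ pow_dvd_pow p (Nat.sub_le m 1)), hk₀ord, Nat.pow_div (Nat.sub_le m 1) hp.pos,
      show m - (m - 1) = 1 by omega, pow_one]
  have hk₁p : ∀ k ∈ AddSubgroup.zmultiples k₁, p • k = 0 := by
    intro k hk
    obtain ⟨a, rfl⟩ := AddSubgroup.mem_zmultiples_iff.mp hk
    rw [smul_comm, ← hk₁ord, addOrderOf_nsmul_eq_zero, smul_zero]
  have hSp : Nat.card (nsmulAddMonoidHom p : S →+ S).ker ≤ p := by
    have hinj'' : Function.Injective (fun q : (nsmulAddMonoidHom p : S →+ S).ker ×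
        AddSubgroup.zmultiples k₁ =>
        (⟨((q.1 : S) : H) + (q.2 : H), by
          change p • (((q.1 : S) : H) + (q.2 : H)) = 0
          have h1 : p • ((q.1 : S) : H) = 0 := by
            have := q.1.2
            rw [AddMonoidHom.mem_ker, nsmulAddMonoidHom_apply] at this
            exact_mod_cast congrArg Subtype.val this
          rw [smul_add, h1, hk₁p _ q.2.2, add_zero]⟩ : (nsmulAddMonoidHom p : H →+ H).ker)) := by
      rintro ⟨s, k⟩ ⟨s', k'⟩ h
      simp only [Subtype.mk.injEq] at h
      obtain ⟨hs, hk⟩ := hsep s.1 s'.1 ⟨k.1, AddSubgroup.zmultiples_le_of_mem hk₁K k.2⟩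
        ⟨k'.1, AddSubgroup.zmultiples_le_of_mem hk₁K k'.2⟩ h
      simp only [Subtype.mk.injEq] at hk
      rw [Subtype.ext hs, Subtype.ext hk]
    have h1 := Nat.card_le_card_of_injective _ hinj''
    rw [Nat.card_prod, Nat.card_zmultiples, hk₁ord] at h1
    have h2 : Nat.card (nsmulAddMonoidHom p : S →+ S).ker * p ≤ p * p := by
      rw [← pow_two]; exact h1.trans hHp
    exact Nat.le_of_mul_le_mul_right h2 hp.pos
  obtain ⟨-, g, hg⟩ := exists_addOrderOf_eq_of_card_ker_le (G := S) hp m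
    (fun g => Subtype.ext (by exact_mod_cast hexp (g : H))) hSp (hScard ▸ le_rfl)
  exact ⟨g, g.2, by rw [← hg, AddSubgroup.addOrderOf_coe]⟩

end Main

end Summit.BirchSwinnertonDyer.Rank1Residual.Additive.TransverseLine

end
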